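import Summits.SmoothPoincare4.SmoothPoincare4.Theorems.SullivanDualAdmissibleJExists
import Summits.SmoothPoincare4.SmoothPoincare4.Theorems.SullivanDualAdmissibleJExistsCoframes

/-!
# Route SullivanDual, support item `AdmissibleJExists` (stmt-SmoothPoincare4-7830), III:
# `AdmissibleJExists` for every homotopy 4-sphere, from the clutching class of its tangent bundle

The general case of the support item `AdmissibleJExists` of route `SullivanDual` (every
punctured homotopy 4-sphere `Σ ∖ p` carries a smooth `J`, `J² = -1`, standard —
`J = (ι ∘ (e − e p))^* J₀` — on a punctured chart-ball at `p`) is an obstruction-theoretic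
statement about `TΣ`: the structure is forced on the punctured ball, and it extends over the
homotopy 4-ball `Σ ∖ ball` iff a class in `π₃(SO(4)/U(2)) = π₃(S²) = ℤ` vanishes, which it does
because `TΣ` has the clutching class of `TS⁴` (Euler number `2`; `p₁ = 0` since homotopy
spheres are s-parallelisable, Kervaire–Milnor Thm. 3.1 / Hirzebruch; Milnor 1956 §3,
Dold–Whitney 1959). None of this algebraic topology (characteristic classes of real vector
bundles, `π₃(SO(4))`) has vocabulary in Mathlib or the tree, so the topological input is isolated
as ONE named fact in frame form,

* §1 `Literature.Topology.FourManifolds.tangentFrame_homotopySphereFour_eq_invertedChartFrame`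
  (NAMED FACT, `Literature/Topology/FourManifolds/HomotopySphereFourTangentClutching.lean`):
  `T(Σ ∖ q)` has a smooth global frame which on a punctured chart-ball at `q` is the coordinate
  frame of the inverted chart `ι ∘ (e − e q)`;

and everything else is PROVED:

* §2 `exists_admissibleJ_of_frame`: such a frame gives the clauses of `AdmissibleJExists` at
  `(M, q)` — `J = Ψ⁻¹ J₀ Ψ` for the dual coframe `Ψ` (`exists_coframe_of_frame`), and on the ball
  `Ψ = Dι ∘ De` since both send `sᵢ ↦ eᵢ` (so the fact implies `AdmissibleJExists`; the
  one-line deduction `admissibleJExists_of_tangentFrame` is landed in the sequel file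
  `SullivanDualAdmissibleJExistsOfTangentClutching.lean`, which imports the named fact).
* §3 consistency: the fact HOLDS for every smooth 4-manifold diffeomorphic to `S⁴`, at every
  point (`tangentFrame_invertedChart_of_nonempty_diffeomorph_sphere`: the frame `(dΦ)⁻¹ eᵢ` for
  the diffeomorphism `Φ : M ∖ q ≃ₘ ℝ⁴` of Palais' chart form,
  `palais_puncturedSphere_chartForm_holds`), so it follows from "every homotopy 4-sphere is
  diffeomorphic to `S⁴`" (sequel file) — it is not refutable short of an exotic 4-sphere, and it
  is implied by the smooth Poincaré conjecture.

References: Dold–Whitney 1959; Kervaire–Milnor 1963, Thm. 3.1; Milnor 1956, §3; Steenrod 1951,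
§18, §23; Kosinski 1993, IX §8; Gromov 1985, §0.3.C; Palais 1960, Thm. B.
-/

-- the registered namespace `Summit.SmoothPoincare4.SmoothPoincare4.Theorems` repeats a component
set_option linter.dupNamespace false

open scoped Manifold ContDiff Topology ContinuousMap
open Set Function ContinuousLinearMap

namespace Summit.SmoothPoincare4.SmoothPoincare4.Theorems.SullivanDual

/-! ### §1 The topological input is the named fact
`Literature.Topology.FourManifolds.tangentFrame_homotopySphereFour_eq_invertedChartFrame`
(`Literature/Topology/FourManifolds/HomotopySphereFourTangentClutching.lean`): `T(Σ ∖ q)` has a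
smooth global frame which near `q` is the coordinate frame of the inverted chart. -/


/-! ### §2 `AdmissibleJExists` from the topological input -/

section Conditional

open Literature.Geometry.Symplectic Literature.Topology.FourManifolds Bundle

/-- **The clauses of `AdmissibleJExists` at `(M, q)` from a smooth frame of `T(M ∖ q)` which is
the inverted-chart coordinate frame near `q`.** With `Ψ` the dual coframe
(`exists_coframe_of_frame`), `J = Ψ⁻¹ J₀ Ψ` is smooth with `J² = -1`; on the punctured ball
`Ψ_x = A = Dι(e x − e q) ∘ De_x` (both send `sᵢ x ↦ eᵢ`), so `A (J v) = J₀ (A v)` and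
`⟪A (J v), b⟫ = ω₀(A v, b)`. [folklore] -/
theorem exists_admissibleJ_of_frame {M : Type*} [TopologicalSpace M] [T2Space M]
    [ChartedSpace (EuclideanSpace ℝ (Fin 4)) M] [IsManifold (𝓡 4) ∞ M] (q : M) {ε : ℝ}
    (hε : 0 < ε) (s : Fin 4 → ∀ x : punctured q, TangentSpace (𝓡 4) x)
    (hs : ∀ i, ContMDiff (𝓡 4) (𝓡 4).tangent ∞ fun x : punctured q =>
      (TotalSpace.mk' (EuclideanSpace ℝ (Fin 4)) x (s i x) : TangentBundle (𝓡 4) (punctured q)))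
    (hli : ∀ x, LinearIndependent ℝ fun i => s i x)
    (hstd : ∀ x, InPuncturedChartBall q ε x → ∀ i,
      fderiv ℝ inversion (extChartAt (𝓡 4) q x.1 - extChartAt (𝓡 4) q q)
        (mfderiv (𝓡 4) 𝓘(ℝ, EuclideanSpace ℝ (Fin 4))
          (fun z : punctured q => extChartAt (𝓡 4) q z.1) x (s i x)) = EuclideanSpace.single i 1) :
    ∃ (J : ∀ x : punctured q, TangentSpace (𝓡 4) x →L[ℝ] TangentSpace (𝓡 4) x) (ε' : ℝ),
      0 < ε' ∧ Metric.closedBall (extChartAt (𝓡 4) q q) ε' ⊆ (extChartAt (𝓡 4) q).target ∧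
      (∀ (x : punctured q) (v : TangentSpace (𝓡 4) x), J x (J x v) = -v) ∧
      (∀ x₀ : punctured q, ContMDiffAt (𝓡 4)
        𝓘(ℝ, EuclideanSpace ℝ (Fin 4) →L[ℝ] EuclideanSpace ℝ (Fin 4)) ∞
        (inTangentCoordinates (𝓡 4) (𝓡 4) (id : punctured q → punctured q) id
          (fun x => J x) x₀) x₀) ∧
      (∀ x : punctured q, InPuncturedChartBall q ε' x →
        ∀ (v : TangentSpace (𝓡 4) x) (b : EuclideanSpace ℝ (Fin 4)),
        inner ℝ (fderiv ℝ inversion (extChartAt (𝓡 4) q x.1 - extChartAt (𝓡 4) q q)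
          (mfderiv (𝓡 4) 𝓘(ℝ, EuclideanSpace ℝ (Fin 4))
            (fun z : punctured q => extChartAt (𝓡 4) q z.1) x (J x v))) b =
        stdSymplecticForm (fderiv ℝ inversion (extChartAt (𝓡 4) q x.1 - extChartAt (𝓡 4) q q)
          (mfderiv (𝓡 4) 𝓘(ℝ, EuclideanSpace ℝ (Fin 4))
            (fun z : punctured q => extChartAt (𝓡 4) q z.1) x v)) b) := by
  -- a closed chart-ball inside the chart target
  obtain ⟨r, hr, hball⟩ : ∃ r > (0 : ℝ),
      Metric.closedBall (extChartAt (𝓡 4) q q) r ⊆ (extChartAt (𝓡 4) q).target := by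
    obtain ⟨r, hr, h⟩ := Metric.isOpen_iff.mp (isOpen_extChartAt_target (I := 𝓡 4) q)
      (extChartAt (𝓡 4) q q) (mem_extChartAt_target (I := 𝓡 4) q)
    exact ⟨r / 2, half_pos hr, (Metric.closedBall_subset_ball (half_lt_self hr)).trans h⟩
  -- the dual coframe and `J = Ψ⁻¹ J₀ Ψ`
  obtain ⟨Ψ, hΨinv, hΨsm, hΨs⟩ :=
    exists_coframe_of_frame s hs hli (fun _ => (0 : EuclideanSpace ℝ (Fin 4)))
  let J : punctured q → EuclideanSpace ℝ (Fin 4) →L[ℝ] EuclideanSpace ℝ (Fin 4) :=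
    fun x => (Ψ x).inverse ∘L stdComplexStructure ∘L Ψ x
  refine ⟨fun x => J x, min ε r, lt_min hε hr,
    (Metric.closedBall_subset_closedBall (min_le_right ε r)).trans hball,
    fun x v => conj_conj stdComplexStructure_sq (hΨinv x) v,
    fun x₀ => contMDiffAt_inTangentCoordinates_conj stdComplexStructure Ψ _ (hΨsm x₀) (hΨinv x₀),
    ?_⟩
  intro x hx v b
  have hxε : InPuncturedChartBall q ε x := ⟨hx.1, Metric.ball_subset_ball (min_le_left ε r) hx.2⟩
  -- `A = Dι(e x − e q) ∘ De_x`, read as a map `ℝ⁴ → ℝ⁴`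
  let A : EuclideanSpace ℝ (Fin 4) →L[ℝ] EuclideanSpace ℝ (Fin 4) :=
    (fderiv ℝ inversion (extChartAt (𝓡 4) q x.1 - extChartAt (𝓡 4) q q)).comp
      (mfderiv (𝓡 4) 𝓘(ℝ, EuclideanSpace ℝ (Fin 4))
        (fun z : punctured q => extChartAt (𝓡 4) q z.1) x)
  -- `A ∘ Ψ_x⁻¹ = 1`: both sides agree on the standard basis, `Ψ_x⁻¹ eᵢ = sᵢ x ↦ eᵢ`
  have hb : ∀ i, EuclideanSpace.basisFun (Fin 4) ℝ i = EuclideanSpace.single i (1 : ℝ) :=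
    fun i => EuclideanSpace.basisFun_apply _ _ i
  have hinv_single : ∀ i, (Ψ x).inverse (EuclideanSpace.single i 1) = s i x :=
    fun i => (hΨinv x).inverse_apply_eq.mpr (hΨs x i).symm
  have hcomp : ((A ∘L (Ψ x).inverse : EuclideanSpace ℝ (Fin 4) →L[ℝ] EuclideanSpace ℝ (Fin 4)) :
      EuclideanSpace ℝ (Fin 4) →ₗ[ℝ] EuclideanSpace ℝ (Fin 4)) =
      ((ContinuousLinearMap.id ℝ (EuclideanSpace ℝ (Fin 4)) :
        EuclideanSpace ℝ (Fin 4) →L[ℝ] EuclideanSpace ℝ (Fin 4)) :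
          EuclideanSpace ℝ (Fin 4) →ₗ[ℝ] EuclideanSpace ℝ (Fin 4)) := by
    refine (EuclideanSpace.basisFun (Fin 4) ℝ).toBasis.ext fun i => ?_
    simp only [OrthonormalBasis.coe_toBasis, hb, ContinuousLinearMap.coe_coe,
      ContinuousLinearMap.coe_comp, Function.comp_apply, ContinuousLinearMap.coe_id,
      hinv_single]
    exact hstd x hxε i
  have hAΨ : ∀ w : EuclideanSpace ℝ (Fin 4), A w = Ψ x w := fun w => by
    have h1 : A ((Ψ x).inverse (Ψ x w)) = Ψ x w := by
      have := LinearMap.congr_fun hcomp (Ψ x w)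
      simpa only [ContinuousLinearMap.coe_coe, ContinuousLinearMap.coe_comp,
        Function.comp_apply, ContinuousLinearMap.coe_id, id_eq, LinearMap.id_coe] using this
    rwa [(hΨinv x).inverse_apply_self] at h1
  have hAw : ∀ w : EuclideanSpace ℝ (Fin 4),
      fderiv ℝ inversion (extChartAt (𝓡 4) q x.1 - extChartAt (𝓡 4) q q)
        (mfderiv (𝓡 4) 𝓘(ℝ, EuclideanSpace ℝ (Fin 4))
          (fun z : punctured q => extChartAt (𝓡 4) q z.1) x w) = Ψ x w :=
    fun w => hAΨ w
  simp only [hAw]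
  erw [apply_conj (hΨinv x) v]
  rw [inner_stdComplexStructure_eq_stdSymplecticForm]

end Conditional

/-! ### §3 Consistency: the topological input holds for every `M ≅ S⁴` -/

section FactSphere

open Literature.Geometry.Symplectic Literature.Topology.FourManifolds Bundle

/-- **The inverted-chart frame extends for every smooth 4-manifold diffeomorphic to `S⁴`**: with
`Φ : M ∖ {q} ≃ₘ ℝ⁴` the diffeomorphism of Palais' chart form agreeing with `ι ∘ (e − e q)` on a
punctured chart-ball, the global frame is `sᵢ = (dΦ)⁻¹ eᵢ` — smooth (its reading in the chart at
`x₀` is `G(x)⁻¹ eᵢ` with `G = dΦ` read in tangent coordinates), a basis everywhere, and on the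
ball `dΦ = Dι ∘ De` (chain rule), so `Dι (De (sᵢ)) = eᵢ`. This is the conclusion of
`tangentFrame_homotopySphereFour_eq_invertedChartFrame` for such `M`, at every point. [folklore] -/
theorem tangentFrame_invertedChart_of_nonempty_diffeomorph_sphere (M : Type) [TopologicalSpace M]
    [T2Space M] [SecondCountableTopology M] [ChartedSpace (EuclideanSpace ℝ (Fin 4)) M]
    [IsManifold (𝓡 4) ∞ M]
    (hM : Nonempty (M ≃ₘ⟮𝓡 4, 𝓡 4⟯ Metric.sphere (0 : EuclideanSpace ℝ (Fin 5)) 1)) (q : M) :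
    ∃ (ε : ℝ) (s : Fin 4 → ∀ x : punctured q, TangentSpace (𝓡 4) x),
      0 < ε ∧
      (∀ i, ContMDiff (𝓡 4) (𝓡 4).tangent ∞ fun x : punctured q =>
        (TotalSpace.mk' (EuclideanSpace ℝ (Fin 4)) x (s i x) : TangentBundle (𝓡 4) (punctured q))) ∧
      (∀ x, LinearIndependent ℝ fun i => s i x) ∧
      ∀ x, InPuncturedChartBall q ε x → ∀ i,
        fderiv ℝ inversion (extChartAt (𝓡 4) q x.1 - extChartAt (𝓡 4) q q)
          (mfderiv (𝓡 4) 𝓘(ℝ, EuclideanSpace ℝ (Fin 4))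
            (fun z : punctured q => extChartAt (𝓡 4) q z.1) x (s i x)) =
          EuclideanSpace.single i 1 := by
  obtain ⟨Φ, ε, hε, hagree⟩ := palais_puncturedSphere_chartForm_holds M q hM
  -- the coframe `dΦ` read as maps `ℝ⁴ → ℝ⁴`, invertible and smooth in tangent coordinates
  let D : punctured q → EuclideanSpace ℝ (Fin 4) →L[ℝ] EuclideanSpace ℝ (Fin 4) :=
    fun x => mfderiv (𝓡 4) 𝓘(ℝ, EuclideanSpace ℝ (Fin 4)) Φ x
  have hDinv : ∀ x, (D x).IsInvertible := fun x =>
    ⟨Φ.mfderivToContinuousLinearEquiv (by simp) x, Φ.mfderivToContinuousLinearEquiv_coe (by simp)⟩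
  have hDsm : ∀ x₀ : punctured q, ContMDiffAt (𝓡 4)
      𝓘(ℝ, EuclideanSpace ℝ (Fin 4) →L[ℝ] EuclideanSpace ℝ (Fin 4)) ∞
      (inTangentCoordinates (𝓡 4) 𝓘(ℝ, EuclideanSpace ℝ (Fin 4)) (id : punctured q → punctured q)
        Φ D x₀) x₀ :=
    fun x₀ => ContMDiffAt.mfderiv_const (Φ.contMDiff x₀) (by simp)
  refine ⟨ε, fun i x => (D x).inverse (EuclideanSpace.single i 1), hε, fun i x₀ => ?_,
    fun x => ?_, fun x hx i => ?_⟩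
  · -- smoothness of the section `x ↦ (dΦ_x)⁻¹ eᵢ`: an inverse column of the smooth coframe `dΦ`
    exact contMDiffAt_inverse_coframe_section D Φ (hDsm x₀) (hDinv x₀) (EuclideanSpace.single i 1)
  · -- a basis: image of the standard basis under the invertible `(dΦ_x)⁻¹`
    have hb : LinearIndependent ℝ (fun i => EuclideanSpace.single i (1 : ℝ) :
        Fin 4 → EuclideanSpace ℝ (Fin 4)) := by
      have h := (EuclideanSpace.basisFun (Fin 4) ℝ).toBasis.linearIndependent
      have hfun : (⇑(EuclideanSpace.basisFun (Fin 4) ℝ).toBasis : Fin 4 → EuclideanSpace ℝ (Fin 4)) =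
          fun i => EuclideanSpace.single i 1 := by
        funext i; rw [OrthonormalBasis.coe_toBasis, EuclideanSpace.basisFun_apply]
      rwa [hfun] at h
    have hker : LinearMap.ker ((D x).inverse : EuclideanSpace ℝ (Fin 4) →ₗ[ℝ]
        EuclideanSpace ℝ (Fin 4)) = ⊥ :=
      LinearMap.ker_eq_bot_of_injective (hDinv x).inverse.injective
    exact hb.map' _ hker
  · -- on the ball `dΦ = Dι ∘ De`, so `Dι (De ((dΦ)⁻¹ eᵢ)) = eᵢ`
    have hev : (⇑Φ : punctured q → EuclideanSpace ℝ (Fin 4)) =ᶠ[𝓝 x]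
        fun z : punctured q => inversion (extChartAt (𝓡 4) q z.1 - extChartAt (𝓡 4) q q) :=
      Filter.eventuallyEq_of_mem ((isOpen_setOf_inPuncturedChartBall q ε).mem_nhds hx)
        fun z hz => hagree z hz.1 hz.2
    have hA : D x = (fderiv ℝ inversion (extChartAt (𝓡 4) q x.1 - extChartAt (𝓡 4) q q)).comp
        (mfderiv (𝓡 4) 𝓘(ℝ, EuclideanSpace ℝ (Fin 4))
          (fun z : punctured q => extChartAt (𝓡 4) q z.1) x) :=
      ((hasMFDerivAt_inversion_extChartAt_sub q x hx.1).congr_of_eventuallyEq hev).mfderiv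
    have hAw : ∀ w : EuclideanSpace ℝ (Fin 4),
        fderiv ℝ inversion (extChartAt (𝓡 4) q x.1 - extChartAt (𝓡 4) q q)
          (mfderiv (𝓡 4) 𝓘(ℝ, EuclideanSpace ℝ (Fin 4))
            (fun z : punctured q => extChartAt (𝓡 4) q z.1) x w) = D x w :=
      fun w => by rw [hA]; rfl
    rw [hAw, (hDinv x).self_apply_inverse]

end FactSphere

end Summit.SmoothPoincare4.SmoothPoincare4.Theorems.SullivanDual
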